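import Literature.Geometry.Riemannian.SphereHeatKernelHarnack
import Literature.Geometry.Riemannian.SphericalZonalFourPositivity
import Literature.Analysis.SpecialFunctions.GegenbauerHeatHarnack
import HarnessLib

/-!
# Hamilton's logarithmic convexity for the zonal heat kernel of `S⁴`
# (`HamiltonLogConvexSphereFour_holds`)

For the typed zonal heat series of the round `S⁴`,
`zonal τ s = ∑_k e^{-k(k+3)τ} (2k+3)/3 · C_k^{(3/2)}(s)` (`SphericalCylinderEntropy.lean`; `vol(S⁴)`
times the heat kernel at time `τ` and geodesic distance `arccos s`), we prove for every `τ > 0`: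

* `convexOn_log_zonal_add_cos` — for every `ε > 0`, `θ ↦ log (zonal τ (cos θ) + ε) + θ²/(4τ)`
  is convex on `ℝ`;
* `zonal_pos`, `zonal_cos_pos` — **`zonal τ > 0` on `[-1, 1]`** (strict positivity of the heat
  kernel of `S⁴`, OUT of the convexity: a zero at `cos θ₀` would force
  `0 ≤ log ε + θ₀²/(4τ)` for every `ε > 0`, by convexity between `±θ₀` and `zonal τ 1 ≥ 1`);
* `convexOn_log_zonal_cos` — **`θ ↦ log (zonal τ (cos θ)) + θ²/(4τ)` is convex on `ℝ`**, R. S.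
  Hamilton's corollary "`log f + s²/4t` is convex along any arc-length geodesic" of his matrix
  Harnack estimate (Comm. Anal. Geom. 1 (1993), p. 114) for `M = S⁴` and `f` the heat kernel;
* `hamiltonLogConvex_zonal`, and the discharge `HamiltonLogConvexSphereFour_holds` of the named
  fact of `SphereHeatKernelHarnack.lean`.

Proof of the convexity: the partial sums of the series at the shifted times `τ + σ`, plus `ε`,
form a polynomial heat flow `gegenbauerHeat 1 b J` (`SphericalZonalFourPositivity.lean`), positive
on `[-1,1] × [0, τ - σ]` for `J` large (uniform convergence, `zonal ≥ 0`); for those,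
`GegenbauerHeatHarnack.convexOn_log_gegenbauerHeat_one` (Hamilton's matrix Harnack inequality by
the Li–Yau–Hamilton maximum principle) makes `θ ↦ log (Σ_{j<J} wt j τ C_j(cos θ) + ε) + θ²/(4(τ-σ))`
convex; let `J → ∞`, then `σ → 0`, then `ε → 0` (pointwise limits of convex functions are
convex, `convexOn_univ_of_tendsto`).  Everything is proved; no named facts are introduced.

## References
* R. S. Hamilton, *A matrix Harnack estimate for the heat equation*, Comm. Anal. Geom. 1 (1993)
  113–126, Main Theorem and p. 114. [Hamilton1993Harnack]
* E. B. Davies, *Heat Kernels and Spectral Theory*, CUP 1989, Ch. 5. [Davies1989]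
-/

noncomputable section

open Set Filter
open scoped Topology BigOperators
open Literature.Geometry.Riemannian.SphericalCylinderEntropy
open Literature.Analysis.SpecialFunctions

namespace Literature.Geometry.Riemannian.SphericalZonalKernelSeries

/-! ### Pointwise limits of convex functions -/

/-- An eventually-convex sequence of functions on `ℝ` has a convex pointwise limit. [folklore] -/
theorem convexOn_univ_of_tendsto {g : ℕ → ℝ → ℝ} {f : ℝ → ℝ}
    (hg : ∀ᶠ n in atTop, ConvexOn ℝ univ (g n))
    (hlim : ∀ x, Tendsto (fun n => g n x) atTop (𝓝 (f x))) : ConvexOn ℝ univ f := by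
  refine ⟨convex_univ, fun x _ y _ a b ha hb hab => ?_⟩
  refine le_of_tendsto_of_tendsto (hlim (a • x + b • y))
    (((hlim x).const_mul a).add ((hlim y).const_mul b)) ?_
  filter_upwards [hg] with n hn
  exact hn.2 (mem_univ x) (mem_univ y) ha hb hab

/-- `1/(n+2) → 0`-type limits: `c / (n + 2) → 0`. [folklore] -/
theorem tendsto_const_div_natCast_add_two (c : ℝ) :
    Tendsto (fun n : ℕ => c / ((n : ℝ) + 2)) atTop (𝓝 0) :=
  tendsto_const_nhds.div_atTop (tendsto_natCast_atTop_atTop.atTop_add tendsto_const_nhds)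

/-! ### Convexity of `log (zonal + ε)` along great circles -/

/-- For `τ > 0` and `ε > 0`, `θ ↦ log (zonal τ (cos θ) + ε) + θ²/(4τ)` is convex on `ℝ`
(Hamilton's inequality for the approximating positive polynomial flows, in the limit).
[cite: Hamilton1993Harnack, Main Theorem and p. 114] -/
theorem convexOn_log_zonal_add_cos {τ ε : ℝ} (hτ : 0 < τ) (hε : 0 < ε) :
    ConvexOn ℝ univ (fun θ : ℝ => Real.log (zonal τ (Real.cos θ) + ε) + θ ^ 2 / (4 * τ)) := by
  have hcos : ∀ θ : ℝ, Real.cos θ ∈ Icc (-1 : ℝ) 1 :=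
    fun θ => ⟨Real.neg_one_le_cos θ, Real.cos_le_one θ⟩
  have hzε : ∀ θ : ℝ, 0 < zonal τ (Real.cos θ) + ε :=
    fun θ => add_pos_of_nonneg_of_pos (zonal_nonneg hτ _ (hcos θ)) hε
  -- ### Step A: the shifted statement, by `J → ∞` in Hamilton's inequality for the flows
  have stepA : ∀ σ : ℝ, 0 < σ → σ < τ → ConvexOn ℝ univ
      (fun θ : ℝ => Real.log (zonal τ (Real.cos θ) + ε) + θ ^ 2 / (4 * (τ - σ))) := by
    intro σ hσ hστ
    have hT : 0 < τ - σ := sub_pos.2 hστ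
    set b : ℕ → ℝ := fun j : ℕ => Real.exp (-((j : ℝ) * ((j : ℝ) + 2 * (1 : ℕ) + 1) * σ)) *
      (((j : ℝ) + (((1 : ℕ) : ℝ) + 1 / 2)) / (((1 : ℕ) : ℝ) + 1 / 2)) +
        if j = 0 then ε else 0 with hb
    have hflow : ∀ (J : ℕ) (s t : ℝ), 0 < J →
        gegenbauerHeat 1 b J s t = ∑ j ∈ Finset.range J, wt j (t + σ) * gegen j s + ε :=
      fun J s t hJ => (partialSum_zonal_add_eq_gegenbauerHeat σ t s ε hJ).symm
    refine convexOn_univ_of_tendsto (g := fun J θ =>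
      Real.log (gegenbauerHeat 1 b J (Real.cos θ) (τ - σ)) + θ ^ 2 / (4 * (τ - σ))) ?_ ?_
    · filter_upwards [eventually_partialSum_add_pos (T := τ) hσ hε, eventually_gt_atTop 0]
        with J hJ hJ0
      refine convexOn_log_gegenbauerHeat_one (T := τ - σ) (fun s hs t ht => ?_) ⟨hT, le_rfl⟩
      rw [hflow J s t hJ0]
      exact hJ s hs (t + σ) ⟨by linarith [ht.1], by linarith [ht.2]⟩
    · intro θ
      have hlim : Tendsto (fun J => gegenbauerHeat 1 b J (Real.cos θ) (τ - σ)) atTop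
          (𝓝 (zonal τ (Real.cos θ) + ε)) := by
        have h := ((summable_wt_mul_gegen hτ (Real.cos θ)).tendsto_sum_tsum_nat).add_const ε
        rw [zonal]
        refine h.congr' ?_
        filter_upwards [eventually_gt_atTop 0] with J hJ0
        rw [hflow J _ _ hJ0, sub_add_cancel]
      exact (hlim.log (hzε θ).ne').add tendsto_const_nhds
  -- ### Step B: `σ → 0`
  have hσn : ∀ n : ℕ, 0 < τ / ((n : ℝ) + 2) ∧ τ / ((n : ℝ) + 2) < τ := fun n =>
    ⟨by positivity, div_lt_self hτ (by linarith [(n.cast_nonneg : (0 : ℝ) ≤ n)])⟩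
  refine convexOn_univ_of_tendsto (g := fun n θ =>
    Real.log (zonal τ (Real.cos θ) + ε) + θ ^ 2 / (4 * (τ - τ / ((n : ℝ) + 2))))
    (Eventually.of_forall fun n => stepA _ (hσn n).1 (hσn n).2) fun θ => ?_
  have h2 : Tendsto (fun n : ℕ => θ ^ 2 / (4 * (τ - τ / ((n : ℝ) + 2)))) atTop
      (𝓝 (θ ^ 2 / (4 * (τ - 0)))) :=
    tendsto_const_nhds.div (tendsto_const_nhds.mul (tendsto_const_nhds.sub
      (tendsto_const_div_natCast_add_two τ))) (by rw [sub_zero]; positivity)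
  rw [sub_zero] at h2
  exact tendsto_const_nhds.add h2

/-! ### Strict positivity of the zonal kernel (out of the convexity) -/

/-- **The zonal heat kernel of `S⁴` is strictly positive on `[-1, 1]`** for `τ > 0`.
[cite: Davies1989, Ch. 5 (strict positivity of heat kernels)] -/
theorem zonal_pos {τ : ℝ} (hτ : 0 < τ) : ∀ c ∈ Icc (-1 : ℝ) 1, 0 < zonal τ c := by
  intro c hc
  refine lt_of_le_of_ne (zonal_nonneg hτ c hc) fun h0 => ?_
  have h1 := one_le_zonal_one hτ
  -- the angle `θ₀ = arccos c ∈ (0, π]` with `cos θ₀ = c`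
  set θ₀ : ℝ := Real.arccos c with hθ₀
  have hcos : Real.cos θ₀ = c := Real.cos_arccos hc.1 hc.2
  have hθ₀pos : 0 < θ₀ := by
    rcases (Real.arccos_nonneg c).eq_or_lt with h | h
    · exfalso
      have : c = 1 := by rw [← hcos, hθ₀, ← h, Real.cos_zero]
      rw [this] at h0
      linarith
    · exact h
  -- the convex functions `φ_ε` between `-θ₀` and `θ₀`, evaluated at `0`
  set ε : ℝ := Real.exp (-(θ₀ ^ 2 / (4 * τ)) - 1) with hε
  have hεpos : 0 < ε := Real.exp_pos _
  have hconv := convexOn_log_zonal_add_cos hτ hεpos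
  have hmid := hconv.2 (mem_univ (-θ₀)) (mem_univ θ₀) (by norm_num : (0 : ℝ) ≤ 1 / 2)
    (by norm_num : (0 : ℝ) ≤ 1 / 2) (by norm_num)
  have hpt : (1 / 2 : ℝ) • (-θ₀) + (1 / 2 : ℝ) • θ₀ = 0 := by
    simp only [smul_eq_mul]; ring
  rw [hpt] at hmid
  simp only [smul_eq_mul, Real.cos_neg, Real.cos_zero, hcos, ← h0, zero_add, neg_pow_two,
    ne_eq, OfNat.ofNat_ne_zero, not_false_eq_true, zero_pow, zero_div, add_zero] at hmid
  -- `hmid : log (zonal τ 1 + ε) ≤ log ε + θ₀²/(4τ)`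
  have hlogε : Real.log ε = -(θ₀ ^ 2 / (4 * τ)) - 1 := by rw [hε, Real.log_exp]
  have hleft : 0 ≤ Real.log (zonal τ 1 + ε) := Real.log_nonneg (by linarith)
  linarith

/-- `zonal τ (cos θ) > 0` for `τ > 0`. [folklore] -/
theorem zonal_cos_pos {τ : ℝ} (hτ : 0 < τ) (θ : ℝ) : 0 < zonal τ (Real.cos θ) :=
  zonal_pos hτ _ ⟨Real.neg_one_le_cos θ, Real.cos_le_one θ⟩

/-! ### Hamilton's logarithmic convexity for the zonal kernel -/

/-- **Hamilton's logarithmic convexity for the zonal heat kernel of `S⁴`**: for `τ > 0`,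
`θ ↦ log (zonal τ (cos θ)) + θ²/(4τ)` is convex on `ℝ`.
[cite: Hamilton1993Harnack, p. 114 (log f + s²/4t is convex along geodesics)] -/
theorem convexOn_log_zonal_cos {τ : ℝ} (hτ : 0 < τ) :
    ConvexOn ℝ univ (fun θ : ℝ => Real.log (zonal τ (Real.cos θ)) + θ ^ 2 / (4 * τ)) := by
  have hεn : ∀ n : ℕ, (0 : ℝ) < 1 / ((n : ℝ) + 2) := fun n => by positivity
  refine convexOn_univ_of_tendsto (g := fun n θ =>
    Real.log (zonal τ (Real.cos θ) + 1 / ((n : ℝ) + 2)) + θ ^ 2 / (4 * τ))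
    (Eventually.of_forall fun n => convexOn_log_zonal_add_cos hτ (hεn n)) fun θ => ?_
  have h1 : Tendsto (fun n : ℕ => zonal τ (Real.cos θ) + 1 / ((n : ℝ) + 2)) atTop
      (𝓝 (zonal τ (Real.cos θ) + 0)) :=
    tendsto_const_nhds.add (tendsto_const_div_natCast_add_two 1)
  rw [add_zero] at h1
  exact (h1.log (zonal_cos_pos hτ θ).ne').add tendsto_const_nhds

/-- **Hamilton's matrix Harnack estimate for the heat kernel of the round `S⁴`, radial form**:
for every `τ > 0`, `θ ↦ zonal τ (cos θ)` is positive and `θ ↦ log (zonal τ (cos θ)) + θ²/(4τ)`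
is convex on `[-π, π]`. [cite: Hamilton1993Harnack, Main Theorem and p. 114] -/
theorem hamiltonLogConvex_zonal :
    ∀ τ : ℝ, 0 < τ →
      (∀ θ : ℝ, 0 < zonal τ (Real.cos θ)) ∧
        ConvexOn ℝ (Set.Icc (-Real.pi) Real.pi)
          (fun θ : ℝ => Real.log (zonal τ (Real.cos θ)) + θ ^ 2 / (4 * τ)) :=
  fun _ hτ => ⟨zonal_cos_pos hτ,
    (convexOn_log_zonal_cos hτ).subset (subset_univ _) (convex_Icc _ _)⟩

end Literature.Geometry.Riemannian.SphericalZonalKernelSeries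

namespace Literature.Geometry.Riemannian.SphereHeatKernelHarnack

/-- **Discharge of the named fact `HamiltonLogConvexSphereFour`** (Hamilton's logarithmic
convexity for the heat kernel of the round `S⁴` along great circles, on the typed zonal series).
[cite: Hamilton1993Harnack, Main Theorem and p. 114] -/
theorem HamiltonLogConvexSphereFour_holds : HamiltonLogConvexSphereFour :=
  Literature.Geometry.Riemannian.SphericalZonalKernelSeries.hamiltonLogConvex_zonal

end Literature.Geometry.Riemannian.SphereHeatKernelHarnack
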